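import Summits.CriticalPhenomena.Ising3DConformalLimit.Theorems.GaussianLimitNotScreened.Negative.Reformulation
import Summits.CriticalPhenomena.Ising3DConformalLimit.Theorems.SubPtolemyInterlacingSubPtolemyFloorScreenedEtaBound
import Summits.CriticalPhenomena.Ising3DConformalLimit.Theorems.SubPtolemyInterlacingSubPtolemyFloorHybridCloses
import Summits.CriticalPhenomena.Ising3DConformalLimit.Theorems.PerfectScreeningGaussianLimitNotScreenedInterlacingBridges
import HarnessLib

/-!
# Crux `GaussianLimitNotScreened` (stmt-CriticalPhenomena-13886), line `free-regular-variation-dcp-window`: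
# the screened axial lower bound at exponent `s` kills every Möbius limit with `Δ > (3 − s)/4`
# (bookkeeping stub F2 of lead c7) and the payer map of the window leaf (β)

THEOREM-ONLY helper file of the crux `Summit.CriticalPhenomena.Ising3DConformalLimit.Theses.PerfectScreening.
GaussianLimitNotScreened` (item stmt-CriticalPhenomena-13886, route PerfectScreening r4): no definitions, no named
facts, closes nothing (`--supports` the item). The crux is split (glue `PerfectScreeningGaussianLimitNotScreenedSplit`,
p137467) into three leaves by the window `Δ ∈ [1/2, 3/4]` of a non-degenerate Möbius-covariant pointwise scaling
limit `(ρ, Δ, S)` of `criticalCorr 3` (`GaussianLimitNotScreenedNegative.dimension_window_and_eta`, Duminil-Copin–Panis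
2025 Thm 1.5); leaf (β) is the open window

  (β)  `∀ ρ Δ S, ρ > 0 on (0,1] → HasPointwiseScalingLimit (criticalCorr 3) ρ S → IsNondegenerateTwoPoint S →
        IsMoebiusCovariant Δ S → 1/2 < Δ → Δ < 3/4 → HasNontrivialU4 S`.

Write `L = log₂(1+√2) ≈ 1.2716` (the sub-Ptolemy threshold of route `SubPtolemyInterlacing`) and
`ScreenedAxisLower s` for the screened axial lower bound of Duminil-Copin–Panis 2025 Thm 1.3 / eq. (1.9) at `d = 3`
with a polynomial gain `n^{s}` in the free state at `β_c(3)` — `c₁ n^{s} / (χ_{4n} + n Σ_{1≤k≤2n} k⟨σ₀σ_{ke₁}⟩) ≤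
⟨σ₀σ_{ne₁}⟩` for `n ≥ N₁` (crux stmt-CriticalPhenomena-15703's line proposition, unfolded verbatim as in the landed
`SubPtolemyFloorScreening.etaBound_of_screenedAxisLower`, p141599, which turns it into `1 + η ≤ (3 − s)/2` for
every existing logarithmic exponent `η(3)`).

What is proved (all by VACUITY — a Möbius limit exhibits `η = 2Δ − 1`; no Gaussianity is used):

* `dimension_le_of_screenedAxisLower` — `ScreenedAxisLower s` (`s ≥ 0`) confines every non-degenerate
  scale-covariant pointwise limit of `criticalCorr 3` to `Δ ≤ (3 − s)/4`.
* `stub_windowAboveOfScreenedAxisLower` (the REGISTERED bookkeeping stub F2 of the crux, verbatim) —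
  `ScreenedAxisLower s` kills every Möbius limit with `(3 − s)/4 < Δ`.
* `noMoebiusLimitAboveHalf_of_screenedAxisLower_one` / `dimension_eq_half_of_screenedAxisLower_one` (E4) — at
  `s ≥ 1` it kills every Möbius limit with `1/2 < Δ` (so all of (β) and (γ)), i.e. pins `Δ = 1/2`.
* `noGaussianWindowLimit_upper_of_conditionalEta` (E1) — the conditional exponent inequality "`η < L − 1` whenever
  `η(3)` exists" pays the UPPER window `L/2 ≤ Δ < 3/4` of (β).
* `noGaussianWindowLimit_upper_of_subPtolemyFloor` (E2) — item stmt-CriticalPhenomena-15703 `SubPtolemyFloor` ALONE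
  pays the upper window (landed `SubPtolemyFloorHybrid.conditionalEta_of_subPtolemyFloor`); with `Interlacing`
  (item 15702, lower window, landed `noGaussianWindowLimit_of_interlacing_of_upperWindow`) leaf (β) follows
  (`noGaussianWindowLimit_of_interlacing_of_subPtolemyFloor`).
* `noGaussianWindowLimit_of_interlacing_of_screenedAxisLower` (E3) — leaf (β) VERBATIM from `Interlacing` and
  `ScreenedAxisLower s` for any `s > 3 − 2L ≈ 0.457`, exactly the exponent range of 15703's registered
  `stub_screenedLemma25`: split on `(3 − s)/4 < Δ` (stub F2) versus `Δ ≤ (3 − s)/4 < L/2` (Interlacing). The strict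
  inequality on `s` is needed: at `s = 3 − 2L` the boundary `Δ = L/2` is excluded by neither input.

Conditional theorems: they credit nothing by themselves (`ScreenedAxisLower s`, `η < L − 1`, `SubPtolemyFloor`,
`Interlacing` are open). Deliberately NOT here: the corner leaf (γ) (sibling stub F1,
`PerfectScreeningGaussianLimitNotScreenedCornerOfScreenedAxisLower`), the leaves themselves.

References: H. Duminil-Copin, R. Panis, *New lower bounds for the (near) critical Ising and φ⁴ models' two-point
functions*, CMP 406 (2025), Theorems 1.3 and 1.5 [DuminilCopinPanis2025LowerBounds]; M. Aizenman, CMP 86 (1982) §1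
(`U₄`) [Aizenman1982].
-/

noncomputable section

namespace Summit.CriticalPhenomena.Ising3DConformalLimit.Cruxes.GaussianLimitNotScreened.FreeRegularVariationDcpWindow

open Filter Topology Set
open Literature.Probability.LatticeModels
open Summit.CriticalPhenomena.Ising3DConformalLimit.Theses.SubPtolemyInterlacing (Interlacing SubPtolemyFloor)
open Summit.CriticalPhenomena.Ising3DConformalLimit.SubPtolemyFloorHybrid (conditionalEta_of_subPtolemyFloor)
open Summit.CriticalPhenomena.Ising3DConformalLimit.SubPtolemyFloorNegative (threshold_lt_three_halves)
open Summit.CriticalPhenomena.Ising3DConformalLimit.SubPtolemyFloorScreening (etaBound_of_screenedAxisLower)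
open Summit.CriticalPhenomena.Ising3DConformalLimit.GaussianLimitNotScreenedNegative (dimension_window_and_eta)

/-! ## (F2) The screened axial lower bound at exponent `s` confines Möbius limits to `Δ ≤ (3 − s)/4` -/

/-- **`ScreenedAxisLower s` confines scaling limits to `Δ ≤ (3 − s)/4`.** If the screened axial lower bound with
gain `n^{s}` (`s ≥ 0`) holds at `β_c(3)` in the free state, then every non-degenerate scale-covariant pointwise
scaling limit `(ρ, Δ, S)` of `criticalCorr 3` (`ρ > 0` on `(0,1]`) has `Δ ≤ (3 − s)/4`: the limit exhibits the
logarithmic exponent `η = 2Δ − 1` (`dimension_window_and_eta`) and the landed `etaBound_of_screenedAxisLower` gives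
`1 + η ≤ (3 − s)/2`. [cite: DuminilCopinPanis2025LowerBounds, Theorem 1.5] -/
theorem dimension_le_of_screenedAxisLower {s : ℝ} (hs : 0 ≤ s)
    (h13 : ∃ c₁ : ℝ, 0 < c₁ ∧ ∃ N₁ : ℕ, 0 < N₁ ∧ ∀ n : ℕ, N₁ ≤ n →
      c₁ * (n : ℝ) ^ s / ((∑ x ∈ box 3 (4 * n), twoPointFree 3 (criticalBeta 3) x) +
            (n : ℝ) ^ (3 - 2) *
              ∑ k ∈ Finset.Icc 1 (2 * n),
                (k : ℝ) * twoPointFree 3 (criticalBeta 3) (Pi.single (⟨0, by omega⟩ : Fin 3) (k : ℤ)))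
        ≤ twoPointFree 3 (criticalBeta 3) (Pi.single (⟨0, by omega⟩ : Fin 3) (n : ℤ)))
    {ρ : ℝ → ℝ} {Δ : ℝ} {S : CorrFamily 3} (hρ : ∀ δ ∈ Set.Ioc (0:ℝ) 1, 0 < ρ δ)
    (hlim : HasPointwiseScalingLimit (criticalCorr 3) ρ S) (hnd : IsNondegenerateTwoPoint S)
    (hsc : IsScaleCovariant Δ S) : Δ ≤ (3 - s) / 4 := by
  have hle : 1 + (2 * Δ - 1) ≤ (3 - s) / 2 :=
    etaBound_of_screenedAxisLower s hs h13 _ (dimension_window_and_eta hρ hlim hnd hsc).2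
  linarith

/-- **REGISTERED BOOKKEEPING STUB F2 `stub_windowAboveOfScreenedAxisLower` (lead c7) — the screened axial lower
bound at exponent `s` kills every Möbius limit with `Δ > (3 − s)/4`.** If `ScreenedAxisLower s` holds (`s ≥ 0`) —
there are `c₁ > 0`, `N₁ ≥ 1` with `c₁ n^{s} / (χ_{4n} + n Σ_{1≤k≤2n} k⟨σ₀σ_{ke₁}⟩) ≤ ⟨σ₀σ_{ne₁}⟩` for `n ≥ N₁` in
the free state at `β_c(3)` (Duminil-Copin–Panis 2025 Thm 1.3 / eq. (1.9) at `d = 3` with a gain `n^{s}`) — then a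
non-degenerate Möbius-covariant pointwise limit of `criticalCorr 3` with dimension `Δ` has `η = 2Δ − 1`
(`dimension_window_and_eta`, scale covariance read off Möbius covariance) and the landed
`etaBound_of_screenedAxisLower` gives `1 + (2Δ − 1) ≤ (3 − s)/2`, i.e. `Δ ≤ (3 − s)/4`
(`dimension_le_of_screenedAxisLower`); hence for `(3 − s)/4 < Δ` the conclusion `HasNontrivialU4 S` holds
vacuously (no Gaussianity used). [cite: DuminilCopinPanis2025LowerBounds, Theorem 1.5] -/
theorem stub_windowAboveOfScreenedAxisLower :
    ∀ s : ℝ, 0 ≤ s →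
    (∃ c₁ : ℝ, 0 < c₁ ∧ ∃ N₁ : ℕ, 0 < N₁ ∧ ∀ n : ℕ, N₁ ≤ n →
      c₁ * (n : ℝ) ^ s / ((∑ x ∈ box 3 (4 * n), twoPointFree 3 (criticalBeta 3) x) +
            (n : ℝ) ^ (3 - 2) *
              ∑ k ∈ Finset.Icc 1 (2 * n),
                (k : ℝ) * twoPointFree 3 (criticalBeta 3) (Pi.single (⟨0, by omega⟩ : Fin 3) (k : ℤ)))
        ≤ twoPointFree 3 (criticalBeta 3) (Pi.single (⟨0, by omega⟩ : Fin 3) (n : ℤ))) →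
    ∀ (ρ : ℝ → ℝ) (Δ : ℝ) (S : CorrFamily 3), (∀ δ ∈ Set.Ioc (0:ℝ) 1, 0 < ρ δ) →
      HasPointwiseScalingLimit (criticalCorr 3) ρ S → IsNondegenerateTwoPoint S →
      IsMoebiusCovariant Δ S → (3 - s) / 4 < Δ → HasNontrivialU4 S :=
  fun _ hs h13 _ _ _ hρ hlim hnd hM hΔ =>
    absurd (dimension_le_of_screenedAxisLower hs h13 hρ hlim hnd hM.isScaleCovariant) (not_le.mpr hΔ)

/-! ## (E4) At gain `s ≥ 1` the screened axial lower bound pins `Δ = 1/2` -/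

/-- **(E4) `ScreenedAxisLower s` with `s ≥ 1` kills every Möbius limit with `Δ > 1/2`** (then `(3 − s)/4 ≤ 1/2 < Δ`
and stub F2 applies); in particular it pays all of leaf (β) and the corner leaf (γ). (For `s > 1` the hypothesis is
incompatible with the infrared bound `⟨σ₀σ_x⟩ ≤ C/‖x‖`, which makes the denominator `O(n²)` while the right side is
`O(1/n)`; the case of content is `s = 1`, axial mean-field decay.) [folklore] -/
theorem noMoebiusLimitAboveHalf_of_screenedAxisLower_one {s : ℝ} (hs : 1 ≤ s)
    (h13 : ∃ c₁ : ℝ, 0 < c₁ ∧ ∃ N₁ : ℕ, 0 < N₁ ∧ ∀ n : ℕ, N₁ ≤ n →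
      c₁ * (n : ℝ) ^ s / ((∑ x ∈ box 3 (4 * n), twoPointFree 3 (criticalBeta 3) x) +
            (n : ℝ) ^ (3 - 2) *
              ∑ k ∈ Finset.Icc 1 (2 * n),
                (k : ℝ) * twoPointFree 3 (criticalBeta 3) (Pi.single (⟨0, by omega⟩ : Fin 3) (k : ℤ)))
        ≤ twoPointFree 3 (criticalBeta 3) (Pi.single (⟨0, by omega⟩ : Fin 3) (n : ℤ))) :
    ∀ (ρ : ℝ → ℝ) (Δ : ℝ) (S : CorrFamily 3), (∀ δ ∈ Set.Ioc (0:ℝ) 1, 0 < ρ δ) →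
      HasPointwiseScalingLimit (criticalCorr 3) ρ S → IsNondegenerateTwoPoint S →
      IsMoebiusCovariant Δ S → 1 / 2 < Δ → HasNontrivialU4 S :=
  fun ρ Δ S hρ hlim hnd hM hgt =>
    stub_windowAboveOfScreenedAxisLower s (by linarith) h13 ρ Δ S hρ hlim hnd hM (by linarith)

/-- **(E4′) `ScreenedAxisLower s` with `s ≥ 1` pins every scaling dimension to `Δ = 1/2`**: the window
`1/2 ≤ Δ` (`dimension_window_and_eta`, Duminil-Copin–Panis 2025 Thm 1.5 with the infrared bound) meets
`Δ ≤ (3 − s)/4 ≤ 1/2` (`dimension_le_of_screenedAxisLower`). [cite: DuminilCopinPanis2025LowerBounds, Theorem 1.5] -/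
theorem dimension_eq_half_of_screenedAxisLower_one {s : ℝ} (hs : 1 ≤ s)
    (h13 : ∃ c₁ : ℝ, 0 < c₁ ∧ ∃ N₁ : ℕ, 0 < N₁ ∧ ∀ n : ℕ, N₁ ≤ n →
      c₁ * (n : ℝ) ^ s / ((∑ x ∈ box 3 (4 * n), twoPointFree 3 (criticalBeta 3) x) +
            (n : ℝ) ^ (3 - 2) *
              ∑ k ∈ Finset.Icc 1 (2 * n),
                (k : ℝ) * twoPointFree 3 (criticalBeta 3) (Pi.single (⟨0, by omega⟩ : Fin 3) (k : ℤ)))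
        ≤ twoPointFree 3 (criticalBeta 3) (Pi.single (⟨0, by omega⟩ : Fin 3) (n : ℤ)))
    {ρ : ℝ → ℝ} {Δ : ℝ} {S : CorrFamily 3} (hρ : ∀ δ ∈ Set.Ioc (0:ℝ) 1, 0 < ρ δ)
    (hlim : HasPointwiseScalingLimit (criticalCorr 3) ρ S) (hnd : IsNondegenerateTwoPoint S)
    (hsc : IsScaleCovariant Δ S) : Δ = 1 / 2 := by
  have hlo := (dimension_window_and_eta hρ hlim hnd hsc).1.1
  have hhi := dimension_le_of_screenedAxisLower (by linarith) h13 hρ hlim hnd hsc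
  linarith

/-! ## (E1)/(E2) The conditional exponent inequality, hence item 15703 alone, pays the upper window -/

/-- **(E1) "`η(3) < log₂(1+√2) − 1` whenever `η(3)` exists" pays the UPPER window of leaf (β).** If every
logarithmic critical exponent `η` of `⟨σ₀σ_x⟩_{β_c(3)}` satisfies `η < log₂(1+√2) − 1`, then every non-degenerate
Möbius-covariant pointwise scaling limit of `criticalCorr 3` with `log₂(1+√2) ≤ 2Δ` (and `Δ < 3/4`) has `U₄ ≢ 0` —
vacuously: such a limit exhibits `η = 2Δ − 1 ≥ log₂(1+√2) − 1` (`dimension_window_and_eta`).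
[cite: DuminilCopinPanis2025LowerBounds, Theorem 1.5] -/
theorem noGaussianWindowLimit_upper_of_conditionalEta
    (hC : ∀ η : ℝ, HasIsingExponentEta 3 η → η < Real.logb 2 (1 + Real.sqrt 2) - 1) :
    ∀ (ρ : ℝ → ℝ) (Δ : ℝ) (S : CorrFamily 3), (∀ δ ∈ Set.Ioc (0:ℝ) 1, 0 < ρ δ) →
      HasPointwiseScalingLimit (criticalCorr 3) ρ S → IsNondegenerateTwoPoint S →
      IsMoebiusCovariant Δ S → Real.logb 2 (1 + Real.sqrt 2) ≤ 2 * Δ → Δ < 3 / 4 → HasNontrivialU4 S := by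
  intro ρ Δ S hρ hlim hnd hM hge _
  have hlt := hC _ (dimension_window_and_eta hρ hlim hnd hM.isScaleCovariant).2
  exact absurd hge (not_le.mpr (by linarith))

/-- **(E2) Item stmt-CriticalPhenomena-15703 `SubPtolemyFloor` ALONE pays the upper window `log₂(1+√2)/2 ≤ Δ < 3/4`
of leaf (β).** The axial floor of route `SubPtolemyInterlacing` forces `η < log₂(1+√2) − 1` for every existing
logarithmic exponent `η(3)` (landed `SubPtolemyFloorHybrid.conditionalEta_of_subPtolemyFloor`), so (E1) applies.
(The crux notes §6 recorded only `15702 ∧ 15703 ⇒ (β)`; `Interlacing` is needed for the lower window alone.)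
[cite: DuminilCopinPanis2025LowerBounds, Theorem 1.5] -/
theorem noGaussianWindowLimit_upper_of_subPtolemyFloor (hF : SubPtolemyFloor) :
    ∀ (ρ : ℝ → ℝ) (Δ : ℝ) (S : CorrFamily 3), (∀ δ ∈ Set.Ioc (0:ℝ) 1, 0 < ρ δ) →
      HasPointwiseScalingLimit (criticalCorr 3) ρ S → IsNondegenerateTwoPoint S →
      IsMoebiusCovariant Δ S → Real.logb 2 (1 + Real.sqrt 2) ≤ 2 * Δ → Δ < 3 / 4 → HasNontrivialU4 S :=
  noGaussianWindowLimit_upper_of_conditionalEta (conditionalEta_of_subPtolemyFloor hF)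

/-- **Kernel check of the payer map of leaf (β): `Interlacing ∧ SubPtolemyFloor ⇒ (β)` verbatim** — the lower window
`2Δ < log₂(1+√2)` by `Interlacing` (landed `noGaussianWindowLimit_of_interlacing_of_upperWindow`), the upper one by
`SubPtolemyFloor` alone (E2). [cite: Aizenman1982, §1] -/
theorem noGaussianWindowLimit_of_interlacing_of_subPtolemyFloor (hI : Interlacing) (hF : SubPtolemyFloor) :
    ∀ (ρ : ℝ → ℝ) (Δ : ℝ) (S : CorrFamily 3), (∀ δ ∈ Set.Ioc (0:ℝ) 1, 0 < ρ δ) →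
      HasPointwiseScalingLimit (criticalCorr 3) ρ S → IsNondegenerateTwoPoint S →
      IsMoebiusCovariant Δ S → 1 / 2 < Δ → Δ < 3 / 4 → HasNontrivialU4 S :=
  noGaussianWindowLimit_of_interlacing_of_upperWindow hI (noGaussianWindowLimit_upper_of_subPtolemyFloor hF)

/-! ## (E3) Leaf (β) from `Interlacing` and the screened axial lower bound at any gain `s > 3 − 2·log₂(1+√2)` -/

/-- **(E3) `Interlacing ∧ ScreenedAxisLower s ⇒ (β)` verbatim, for every `s > 3 − 2·log₂(1+√2) ≈ 0.457`** — exactly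
the exponent range `3 − 2·log₂(1+√2) < s` of crux 15703's registered `stub_screenedLemma25`. Such an `s` is `≥ 0`
(`log₂(1+√2) < 3/2`, tree `threshold_lt_three_halves`). Given a Möbius limit with `1/2 < Δ < 3/4`, split on
`(3 − s)/4 < Δ`: there stub F2 applies; otherwise `2Δ ≤ (3 − s)/2 < log₂(1+√2)` and `Interlacing` excludes
Gaussianity (landed `noGaussianLimitBelowThreshold_of_interlacing`). The strict inequality on `s` is necessary for
this argument: at `s = 3 − 2·log₂(1+√2)` the boundary dimension `Δ = log₂(1+√2)/2` is excluded by neither input.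
[cite: DuminilCopinPanis2025LowerBounds, Theorem 1.5] -/
theorem noGaussianWindowLimit_of_interlacing_of_screenedAxisLower (hI : Interlacing) {s : ℝ}
    (hs : 3 - 2 * Real.logb 2 (1 + Real.sqrt 2) < s)
    (h13 : ∃ c₁ : ℝ, 0 < c₁ ∧ ∃ N₁ : ℕ, 0 < N₁ ∧ ∀ n : ℕ, N₁ ≤ n →
      c₁ * (n : ℝ) ^ s / ((∑ x ∈ box 3 (4 * n), twoPointFree 3 (criticalBeta 3) x) +
            (n : ℝ) ^ (3 - 2) *
              ∑ k ∈ Finset.Icc 1 (2 * n),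
                (k : ℝ) * twoPointFree 3 (criticalBeta 3) (Pi.single (⟨0, by omega⟩ : Fin 3) (k : ℤ)))
        ≤ twoPointFree 3 (criticalBeta 3) (Pi.single (⟨0, by omega⟩ : Fin 3) (n : ℤ))) :
    ∀ (ρ : ℝ → ℝ) (Δ : ℝ) (S : CorrFamily 3), (∀ δ ∈ Set.Ioc (0:ℝ) 1, 0 < ρ δ) →
      HasPointwiseScalingLimit (criticalCorr 3) ρ S → IsNondegenerateTwoPoint S →
      IsMoebiusCovariant Δ S → 1 / 2 < Δ → Δ < 3 / 4 → HasNontrivialU4 S := by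
  have hL := threshold_lt_three_halves
  have hs0 : 0 ≤ s := by linarith
  intro ρ Δ S hρ hlim hnd hM _ _
  rcases lt_or_ge ((3 - s) / 4) Δ with habove | hbelow
  · exact stub_windowAboveOfScreenedAxisLower s hs0 h13 ρ Δ S hρ hlim hnd hM habove
  · exact noGaussianLimitBelowThreshold_of_interlacing hI ρ Δ S hρ hlim hnd hM (by linarith)

end Summit.CriticalPhenomena.Ising3DConformalLimit.Cruxes.GaussianLimitNotScreened.FreeRegularVariationDcpWindow

end
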